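import Summits.QuantumAdvantage.QuantumAdvantage.Theorems.RingPeriodFoldStrategies
import Summits.QuantumAdvantage.AdviceFreeQNC0.RingSymmetrization
import HarnessLib

/-!
# Low-degree leader election over `𝔽₃` (A): comparison polynomial and Razborov product

Cell decomp-qadv, seat lens-2 («structural dichotomy: special vs generic»), generation 12 — LAND-READY tree
twin of the node `HOME/decomp-qadv-lens-2/g12/LeaderDial.lean` (node sha256 ef4b277d…; farm rc 0 · 0 sorries ·
axioms {propext, Classical.choice, Quot.sound}).  Explicit binders, no new `Prop` items; `decide` is used only on
closed `ZMod 3` literals.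

`𝔽₃` LEADER ELECTION, part A: the lexicographic comparison polynomial and the Razborov product.

* `ι3`, `coord3` — Boolean inputs embedded in `𝔽₃`; `ltTerm3`, `ltPoly3` — the indicator of
  `win(rot_k x) <_lex win(x)` on the cyclic window of length `ℓ` as an `𝔽₃`-polynomial of degree `≤ 2ℓ`
  (`ltPoly3_apply`: exact, the first-difference terms are pairwise exclusive);
* `tally σ = Σ_{k ∈ σ, k ≠ 0} ltPoly3 k` (degree `≤ 2ℓ`), `elect3 ω = Π_s (1 − tally (ω s)²)` (degree `≤ 4tℓ`,
  values in `{0,1}`), `elect3 = 1 ↔ all tallies vanish`, and `elect3 = [Good]` on good inputs.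

The tree has the `𝔽₂` version (`LeaderElectionPolynomial`, OR-amplification); over `𝔽₃` the rounds are the
Razborov/Smolensky products `1 − tally²`, which is what makes the mod-3 toggling count of part B work.
-/

set_option linter.dupNamespace false

noncomputable section

open scoped Classical

namespace Summit.QuantumAdvantage.QuantumAdvantage.Theorems

open Finset
open Literature.Computability.QuantumComplexity Literature.Computability.QuantumComplexity.RingHLF
open Literature.Computability.MetaComplexity Literature.Computability.MetaComplexity.Smolensky
open Summit.QuantumAdvantage.AdviceFreeQNC0
open Summit.QuantumAdvantage.AdviceFreeQNC0.RingSymmetry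
open Summit.QuantumAdvantage.AdviceFreeQNC0.LeaderElection
open Summit.QuantumAdvantage.QuantumAdvantage.Theorems.RingPeriodFold (cov covStrat covLosing
  mem_covLosing covStrat_mem_lowDeg cov_eq_covStrat ind_rot_mem')

namespace RingLeaderElection3

variable {n : ℕ}

/-- `𝔽₃`-indicator of a Boolean. -/
def ι3 (b : Bool) : ZMod 3 := if b = true then 1 else 0

/-- the coordinate function `x ↦ [x_j] ∈ 𝔽₃`. -/
def coord3 (j : Fin n) : CubeFn (ZMod 3) n := fun x => ι3 (x j)

/-- `coord3 j` has degree `≤ 1`. -/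
theorem coord3_mem (j : Fin n) : coord3 j ∈ lowDeg (ZMod 3) n 1 := by
  have e : coord3 j = mono (ZMod 3) ({j} : Finset (Fin n)) := by
    funext x; rw [mono_apply]; simp [coord3, ι3]
  rw [e]; exact mono_mem_lowDeg (by simp)

/-- the `j`-th term of the `𝔽₃` lexicographic comparison polynomial of the windows at `0` and `k`:
`Π_{i<j} (1 − (X_i − Y_i)²) · (1 − X_j) · Y_j`. -/
def ltTerm3 (hn : 0 < n) (ℓ k : ℕ) (j : Fin ℓ) : CubeFn (ZMod 3) n :=
  (∏ i ∈ univ.filter (fun i : Fin ℓ => i < j),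
      (1 - (coord3 (idx hn (i.val + 0)) - coord3 (idx hn (i.val + k))) ^ 2)) *
    (1 - coord3 (idx hn (j.val + 0))) * coord3 (idx hn (j.val + k))

/-- **the `𝔽₃` comparison polynomial** `LT³_k = Σ_j ltTerm3 j` (degree `≤ 2ℓ`). -/
def ltPoly3 (hn : 0 < n) (ℓ k : ℕ) : CubeFn (ZMod 3) n := ∑ j : Fin ℓ, ltTerm3 hn ℓ k j

/-- Degree of a comparison term: `≤ 2ℓ`. -/
theorem ltTerm3_mem (hn : 0 < n) (ℓ k : ℕ) (j : Fin ℓ) :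
    ltTerm3 hn ℓ k j ∈ lowDeg (ZMod 3) n (2 * ℓ) := by
  unfold ltTerm3
  have h1 : ∀ i : Fin ℓ, (1 - (coord3 (idx hn (i.val + 0)) - coord3 (idx hn (i.val + k))) ^ 2 :
      CubeFn (ZMod 3) n) ∈ lowDeg (ZMod 3) n 2 := by
    intro i
    have hd : (coord3 (idx hn (i.val + 0)) - coord3 (idx hn (i.val + k)) : CubeFn (ZMod 3) n) ∈
        lowDeg (ZMod 3) n 1 := Submodule.sub_mem _ (coord3_mem _) (coord3_mem _)
    have hsq := pow_mem_lowDeg hd 2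
    rw [show 2 * 1 = 2 from rfl] at hsq
    exact Submodule.sub_mem _ (one_mem_lowDeg 2) hsq
  have hprod := prod_mem_lowDeg (univ.filter fun i : Fin ℓ => i < j) (fun i _ => h1 i)
  have hcard : (univ.filter fun i : Fin ℓ => i < j).card * 2 ≤ (ℓ - 1) * 2 := by
    apply Nat.mul_le_mul_right
    calc (univ.filter fun i : Fin ℓ => i < j).card ≤ (univ.filter fun i : Fin ℓ => i ≠ j).card :=
          card_le_card (fun i hi => by
            rw [mem_filter] at hi ⊢; exact ⟨hi.1, ne_of_lt hi.2⟩)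
      _ = ℓ - 1 := by
          rw [filter_ne' univ j, card_erase_of_mem (mem_univ _), card_univ, Fintype.card_fin]
  have h2 : (1 - coord3 (idx hn (j.val + 0)) : CubeFn (ZMod 3) n) ∈ lowDeg (ZMod 3) n 1 :=
    Submodule.sub_mem _ (one_mem_lowDeg 1) (coord3_mem _)
  have h3 := mul_mem_lowDeg_add (mul_mem_lowDeg_add (lowDeg_mono hcard hprod) h2)
    (coord3_mem (idx hn (j.val + k)))
  refine lowDeg_mono ?_ h3
  have := j.isLt
  omega

/-- Degree of the comparison polynomial: `≤ 2ℓ`. -/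
theorem ltPoly3_mem (hn : 0 < n) (ℓ k : ℕ) : ltPoly3 hn ℓ k ∈ lowDeg (ZMod 3) n (2 * ℓ) :=
  Submodule.sum_mem _ fun j _ => ltTerm3_mem hn ℓ k j

/-- Value of a comparison term: the indicator of `FirstDiff`. -/
theorem ltTerm3_apply (hn : 0 < n) (ℓ k : ℕ) (j : Fin ℓ) (x : Fin n → Bool) :
    ltTerm3 hn ℓ k j x = if FirstDiff (lab hn ℓ 0 x) (lab hn ℓ k x) j then 1 else 0 := by
  have key : ∀ a b : Bool, (1 - (ι3 a - ι3 b) ^ 2 : ZMod 3) = if a = b then 1 else 0 := by decide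
  have key2 : ∀ a : Bool, (1 - ι3 a : ZMod 3) = if a = false then 1 else 0 := by decide
  have key3 : ∀ b : Bool, ι3 b = if b = true then 1 else 0 := by decide
  have hval : ltTerm3 hn ℓ k j x =
      (∏ i ∈ univ.filter (fun i : Fin ℓ => i < j),
          (if lab hn ℓ 0 x i = lab hn ℓ k x i then (1 : ZMod 3) else 0)) *
        (if lab hn ℓ 0 x j = false then (1 : ZMod 3) else 0) *
        (if lab hn ℓ k x j = true then (1 : ZMod 3) else 0) := by
    unfold ltTerm3
    rw [Pi.mul_apply, Pi.mul_apply, Finset.prod_apply]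
    simp only [Pi.sub_apply, Pi.one_apply, Pi.pow_apply, coord3, lab]
    rw [key2, key3]
    congr 1; congr 1
    exact Finset.prod_congr rfl fun i _ => key _ _
  rw [hval, Finset.prod_boole]
  simp only [mem_filter, mem_univ, true_and, FirstDiff]
  by_cases h1 : ∀ i : Fin ℓ, i < j → lab hn ℓ 0 x i = lab hn ℓ k x i <;>
    by_cases h2 : lab hn ℓ 0 x j = false <;>
      by_cases h3 : lab hn ℓ k x j = true <;> simp [h1, h2, h3]

/-- In `𝔽₃`, a sum of indicators of pairwise exclusive events is the indicator of their union. -/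
theorem sum_ite_eq_ite_exists3 {ℓ' : ℕ} (Q : Fin ℓ' → Prop) (hQ : ∀ j j', Q j → Q j' → j = j') :
    (∑ j : Fin ℓ', (if Q j then (1 : ZMod 3) else 0)) = if ∃ j, Q j then 1 else 0 := by
  by_cases hex : ∃ j, Q j
  · obtain ⟨j₀, hj₀⟩ := hex
    rw [if_pos ⟨j₀, hj₀⟩, Finset.sum_eq_single j₀]
    · rw [if_pos hj₀]
    · intro j _ hj; rw [if_neg fun h => hj (hQ j j₀ h hj₀)]
    · intro h; exact absurd (mem_univ _) h
  · rw [if_neg hex]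
    exact Finset.sum_eq_zero fun j _ => by rw [if_neg fun h => hex ⟨j, h⟩]

/-- **The `𝔽₃` comparison polynomial is exact**: `LT³_k(x) = [lab 0 x <_lex lab k x]`. -/
theorem ltPoly3_apply (hn : 0 < n) (ℓ k : ℕ) (x : Fin n → Bool) :
    ltPoly3 hn ℓ k x = if toLex (lab hn ℓ 0 x) < toLex (lab hn ℓ k x) then 1 else 0 := by
  unfold ltPoly3
  rw [Finset.sum_apply]
  simp only [ltTerm3_apply]
  rw [sum_ite_eq_ite_exists3 _ (fun j j' h h' => firstDiff_unique h h')]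
  simp only [exists_firstDiff_iff]

/-! ### The Razborov product over `𝔽₃`: `Π_s (1 − tally_s²)` -/

/-- the mod-3 TALLY `Σ_{k ≠ 0, σ k} (1 − LT³_k)` of offending rotations collected by the subset `σ`. -/
def tally (hn : 0 < n) (ℓ : ℕ) (σ : Fin n → Bool) : CubeFn (ZMod 3) n :=
  ∑ k ∈ univ.filter (fun k : Fin n => k.val ≠ 0 ∧ σ k = true), (1 - ltPoly3 hn ℓ k.val)

/-- **the `𝔽₃` election polynomial** of seed `ω`: `Π_{s<t} (1 − tally(ω s)²)` — Razborov's approximate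
`AND_{k≠0} LT³_k` with squares in place of parities. -/
def elect3 (hn : 0 < n) (ℓ t : ℕ) (ω : Seed n t) : CubeFn (ZMod 3) n :=
  ∏ s : Fin t, (1 - (tally hn ℓ (ω s)) ^ 2)

/-- Degree of a tally: `≤ 2ℓ`. -/
theorem tally_mem (hn : 0 < n) (ℓ : ℕ) (σ : Fin n → Bool) :
    tally hn ℓ σ ∈ lowDeg (ZMod 3) n (2 * ℓ) :=
  Submodule.sum_mem _ fun k _ => Submodule.sub_mem _ (one_mem_lowDeg _) (ltPoly3_mem hn ℓ k.val)

/-- **Degree of the election polynomial**: `≤ t·(2·(2ℓ))`. -/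
theorem elect3_mem (hn : 0 < n) (ℓ t : ℕ) (ω : Seed n t) :
    elect3 hn ℓ t ω ∈ lowDeg (ZMod 3) n (t * (2 * (2 * ℓ))) := by
  have h := prod_mem_lowDeg (univ : Finset (Fin t))
    (fun s _ => Submodule.sub_mem _ (one_mem_lowDeg _) (pow_mem_lowDeg (tally_mem hn ℓ (ω s)) 2))
  rwa [card_univ, Fintype.card_fin] at h

/-- A tally, evaluated. -/
theorem tally_apply (hn : 0 < n) (ℓ : ℕ) (σ : Fin n → Bool) (x : Fin n → Bool) :
    tally hn ℓ σ x = ∑ k : Fin n, if k.val ≠ 0 ∧ σ k = true then 1 - ltPoly3 hn ℓ k.val x else 0 := by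
  unfold tally
  rw [Finset.sum_apply, Finset.sum_filter]
  rfl

/-- On a good input every tally vanishes (all `LT³_k = 1`). -/
theorem tally_apply_of_good (hn : 0 < n) {ℓ : ℕ} {x : Fin n → Bool} (hx : Good hn ℓ x)
    (σ : Fin n → Bool) : tally hn ℓ σ x = 0 := by
  rw [tally_apply]
  refine Finset.sum_eq_zero fun k _ => ?_
  by_cases hk : k.val ≠ 0 ∧ σ k = true
  · rw [if_pos hk, ltPoly3_apply, if_pos (hx k hk.1)]; decide
  · rw [if_neg hk]

/-- `elect3 ω x = 1` iff every tally vanishes at `x`. -/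
theorem elect3_apply_eq_one_iff (hn : 0 < n) (ℓ t : ℕ) (ω : Seed n t) (x : Fin n → Bool) :
    elect3 hn ℓ t ω x = 1 ↔ ∀ s : Fin t, tally hn ℓ (ω s) x = 0 := by
  unfold elect3
  rw [Finset.prod_apply]
  simp only [Pi.sub_apply, Pi.one_apply, Pi.pow_apply]
  have h1 : ∀ p : ZMod 3, 1 - p ^ 2 = 1 ↔ p = 0 := by decide
  have h01 : ∀ p : ZMod 3, 1 - p ^ 2 = 0 ∨ 1 - p ^ 2 = 1 := by decide
  constructor
  · intro h s
    by_contra hs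
    have h0 : (1 - (tally hn ℓ (ω s) x) ^ 2) = 0 := by
      rcases h01 (tally hn ℓ (ω s) x) with h' | h'
      · exact h'
      · exact absurd ((h1 _).1 h') hs
    rw [Finset.prod_eq_zero (mem_univ s) h0] at h
    exact zero_ne_one h
  · intro h
    exact Finset.prod_eq_one fun s _ => (h1 _).2 (h s)

/-- If some tally does not vanish, the election polynomial reads `0`. -/
theorem elect3_apply_eq_zero (hn : 0 < n) (ℓ t : ℕ) (ω : Seed n t) (x : Fin n → Bool)
    (h : ¬ ∀ s : Fin t, tally hn ℓ (ω s) x = 0) : elect3 hn ℓ t ω x = 0 := by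
  obtain ⟨s, hs⟩ := not_forall.1 h
  unfold elect3
  rw [Finset.prod_apply]
  simp only [Pi.sub_apply, Pi.one_apply, Pi.pow_apply]
  have h01 : ∀ p : ZMod 3, p ≠ 0 → 1 - p ^ 2 = 0 := by decide
  exact Finset.prod_eq_zero (mem_univ s) (h01 _ hs)

/-- The election polynomial is `{0,1}`-valued. -/
theorem elect3_zero_or_one (hn : 0 < n) (ℓ t : ℕ) (ω : Seed n t) (x : Fin n → Bool) :
    elect3 hn ℓ t ω x = 0 ∨ elect3 hn ℓ t ω x = 1 := by
  by_cases h : ∀ s : Fin t, tally hn ℓ (ω s) x = 0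
  · exact Or.inr ((elect3_apply_eq_one_iff hn ℓ t ω x).2 h)
  · exact Or.inl (elect3_apply_eq_zero hn ℓ t ω x h)

/-- On a good input the election polynomial fires, for EVERY seed. -/
theorem elect3_apply_of_good (hn : 0 < n) {ℓ : ℕ} (t : ℕ) (ω : Seed n t) {x : Fin n → Bool}
    (hx : Good hn ℓ x) : elect3 hn ℓ t ω x = 1 :=
  (elect3_apply_eq_one_iff hn ℓ t ω x).2 fun s => tally_apply_of_good hn hx (ω s)


end RingLeaderElection3

end Summit.QuantumAdvantage.QuantumAdvantage.Theorems
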